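import Literature.AlgebraicGeometry.ShimuraVarieties.UnitaryBallQuotientDatum

/-!
# From the Sylvester normalisation to entry bounds for `U(H^{τ₁})` (crux
# `EndoscopicMiddleDegree.OrthogonalEnveloped`, stmt-HodgeConjecture-14300; `--supports`; seat c2, 2026-08-16)

Brick "(arch), place of `τ₁`, conjugation step" of the registered residual stub `stub_archimedeanBound`:
the datum normalises its form at `τ₁` by `Tᴴ H^{τ₁} T = S`, `S = diag(1,…,1,-1)` (`signature_τ₁`). For an
isometry `γ` of `H^{τ₁}` the conjugate `g = T⁻¹ γ T` preserves `S` on BOTH sides (`gᴴ S g = S`, and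
`g S gᴴ = S` because `S² = 1` and `g` is invertible), so the landed `stub_indefiniteUnitaryEntryBound`
(p107948; taken here as a hypothesis, its module not yet served by the farm) bounds every entry of `g` by
its corner entry, and `γ = T g T⁻¹` has entries bounded by `C(T) · |g_{last,last}|`.

* `stub_sylvesterEntryBound` (REGISTERED stub of the crux).

References: BMM arXiv:1306.1515 Part 2 §1.1 ("choosing a suitable isomorphism `V_τ ≅ ℂᵐ` we may write
`(u,v) = ᵗū H_{p,q} v`").
-/

noncomputable section

-- The crux-workfile namespace `Summit.<P>.<Sub>.Cruxes.…` repeats `HodgeConjecture` (single-conjunct summit).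
set_option linter.dupNamespace false

namespace Summit.HodgeConjecture.HodgeConjecture.Cruxes.OrthogonalEnveloped.HeckeGraphChow

open scoped BigOperators ComplexConjugate
open Matrix Literature.AlgebraicGeometry.ShimuraVarieties

/-- `S² = 1` for the signature matrix `S = diag(1, …, 1, -1)`. [folklore] -/
theorem signatureMatrix_mul_self (p : ℕ) : signatureMatrix p * signatureMatrix p = 1 := by
  rw [signatureMatrix, Matrix.diagonal_mul_diagonal, ← Matrix.diagonal_one]
  congr 1
  funext i
  split_ifs <;> norm_num

/-- **A one-sided isometry of `S` is two-sided**: for invertible `g`, `gᴴ S g = S` implies `g S gᴴ = S`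
(`(g S gᴴ S) g = g S (gᴴ S g) = g S S = g`, cancel `g`, and `S⁻¹ = S`). [folklore] -/
theorem mul_signatureMatrix_mul_conjTranspose_of {p : ℕ} (g : GL (Fin (p + 1)) ℂ)
    (h : (g : Matrix (Fin (p + 1)) (Fin (p + 1)) ℂ)ᴴ * signatureMatrix p * (g : Matrix (Fin (p + 1)) (Fin (p + 1)) ℂ) = signatureMatrix p) :
    (g : Matrix (Fin (p + 1)) (Fin (p + 1)) ℂ) * signatureMatrix p * (g : Matrix (Fin (p + 1)) (Fin (p + 1)) ℂ)ᴴ = signatureMatrix p := by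
  set S := signatureMatrix p with hS
  set G : Matrix (Fin (p + 1)) (Fin (p + 1)) ℂ := (↑g : Matrix (Fin (p + 1)) (Fin (p + 1)) ℂ) with hG
  have hGinv : G * ((g⁻¹ : GL (Fin (p + 1)) ℂ) : Matrix (Fin (p + 1)) (Fin (p + 1)) ℂ) = 1 := by
    rw [hG, ← Units.val_mul, mul_inv_cancel, Units.val_one]
  have key : (G * S * Gᴴ * S) * G = G := by
    calc (G * S * Gᴴ * S) * G = G * S * (Gᴴ * S * G) := by simp only [Matrix.mul_assoc]
      _ = G * S * S := by rw [h]
      _ = G := by rw [Matrix.mul_assoc, signatureMatrix_mul_self, Matrix.mul_one]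
  have key2 : G * S * Gᴴ * S = 1 := by
    have h' := congrArg (fun M : Matrix (Fin (p + 1)) (Fin (p + 1)) ℂ ↦ M * ((g⁻¹ : GL (Fin (p + 1)) ℂ) : Matrix (Fin (p + 1)) (Fin (p + 1)) ℂ)) key
    simpa only [Matrix.mul_assoc, hGinv, Matrix.mul_one] using h'
  calc G * S * Gᴴ = (G * S * Gᴴ * S) * S := by
        rw [Matrix.mul_assoc (G * S * Gᴴ), signatureMatrix_mul_self, Matrix.mul_one]
    _ = S := by rw [key2, Matrix.one_mul]

/-- Entries of a triple product are bounded by the entries of the middle factor: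
`‖(A M B) i j‖ ≤ (Σ_{l,k} ‖A i k‖ ‖B l j‖) · c` if `‖M k l‖ ≤ c`. [folklore] -/
theorem norm_mul_mul_apply_le {p : ℕ} (A M B : Matrix (Fin (p + 1)) (Fin (p + 1)) ℂ) {c : ℝ}
    (hc : ∀ k l, ‖M k l‖ ≤ c) (i j : Fin (p + 1)) :
    ‖(A * M * B) i j‖ ≤ (∑ l, ∑ k, ‖A i k‖ * ‖B l j‖) * c := by
  have hexp : (A * M * B) i j = ∑ l, ∑ k, A i k * M k l * B l j := by
    simp only [Matrix.mul_apply, Finset.sum_mul]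
  rw [hexp]
  calc ‖∑ l, ∑ k, A i k * M k l * B l j‖ ≤ ∑ l, ‖∑ k, A i k * M k l * B l j‖ := norm_sum_le _ _
    _ ≤ ∑ l, ∑ k, ‖A i k * M k l * B l j‖ := Finset.sum_le_sum fun l _ ↦ norm_sum_le _ _
    _ ≤ ∑ l, ∑ k, ‖A i k‖ * ‖B l j‖ * c := by
        refine Finset.sum_le_sum fun l _ ↦ Finset.sum_le_sum fun k _ ↦ ?_
        rw [norm_mul, norm_mul]
        calc ‖A i k‖ * ‖M k l‖ * ‖B l j‖ ≤ ‖A i k‖ * c * ‖B l j‖ := by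
              gcongr
              exact hc k l
          _ = ‖A i k‖ * ‖B l j‖ * c := by ring
    _ = (∑ l, ∑ k, ‖A i k‖ * ‖B l j‖) * c := by simp only [Finset.sum_mul]

/-- **REGISTERED STUB `stub_sylvesterEntryBound` (seat c2): entries of the isometries of a form of
signature `(p,1)` are bounded by a constant times the corner entry of their Sylvester conjugate.** Given
the entry bound for `U(p,1)` (the statement of the landed `stub_indefiniteUnitaryEntryBound`, as a
hypothesis) and `T` with `Tᴴ Hc T = S`: there is `C` (depending on `T`) with
`‖γ i j‖ ≤ C · ‖(T⁻¹ γ T)_{last,last}‖` for every `γ ∈ GL` with `γᴴ Hc γ = Hc`.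
[cite: BergeronMillsonMoeglin2016Balls, Part 2 §1.1] -/
theorem stub_sylvesterEntryBound :
    (∀ (p : ℕ) (g : Matrix (Fin (p + 1)) (Fin (p + 1)) ℂ),
      gᴴ * signatureMatrix p * g = signatureMatrix p →
      g * signatureMatrix p * gᴴ = signatureMatrix p →
      ∀ i j, ‖g i j‖ ≤ ‖g (Fin.last p) (Fin.last p)‖) →
    ∀ (p : ℕ) (Hc : Matrix (Fin (p + 1)) (Fin (p + 1)) ℂ) (T : GL (Fin (p + 1)) ℂ),
      (T : Matrix (Fin (p + 1)) (Fin (p + 1)) ℂ)ᴴ * Hc * (T : Matrix (Fin (p + 1)) (Fin (p + 1)) ℂ) =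
        signatureMatrix p →
      ∃ C : ℝ, ∀ γ : GL (Fin (p + 1)) ℂ,
        (γ : Matrix (Fin (p + 1)) (Fin (p + 1)) ℂ)ᴴ * Hc * (γ : Matrix (Fin (p + 1)) (Fin (p + 1)) ℂ) =
          Hc →
        ∀ i j, ‖(γ : Matrix (Fin (p + 1)) (Fin (p + 1)) ℂ) i j‖ ≤
          C * ‖((T⁻¹ * γ * T : GL (Fin (p + 1)) ℂ) : Matrix (Fin (p + 1)) (Fin (p + 1)) ℂ)
            (Fin.last p) (Fin.last p)‖ := by
  intro hbound p Hc T hT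
  set Tm : Matrix (Fin (p + 1)) (Fin (p + 1)) ℂ := (↑T : Matrix (Fin (p + 1)) (Fin (p + 1)) ℂ) with hTm
  set Ti : Matrix (Fin (p + 1)) (Fin (p + 1)) ℂ := ((T⁻¹ : GL (Fin (p + 1)) ℂ) : Matrix (Fin (p + 1)) (Fin (p + 1)) ℂ) with hTi
  refine ⟨∑ i, ∑ j, ∑ l, ∑ k, ‖Tm i k‖ * ‖Ti l j‖, fun γ hγ i j ↦ ?_⟩
  set γm : Matrix (Fin (p + 1)) (Fin (p + 1)) ℂ := (↑γ : Matrix (Fin (p + 1)) (Fin (p + 1)) ℂ) with hγm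
  have hTinv' : Tm * Ti = 1 := by
    rw [hTm, hTi, ← Units.val_mul, mul_inv_cancel, Units.val_one]
  -- `Hc = T⁻ᴴ S T⁻¹`
  have hHc : Tiᴴ * signatureMatrix p * Ti = Hc := by
    rw [← hT]
    calc Tiᴴ * (Tmᴴ * Hc * Tm) * Ti = (Tm * Ti)ᴴ * Hc * (Tm * Ti) := by
          rw [Matrix.conjTranspose_mul]; simp only [Matrix.mul_assoc]
      _ = Hc := by rw [hTinv', Matrix.conjTranspose_one, Matrix.one_mul, Matrix.mul_one]
  -- the Sylvester conjugate `g = T⁻¹ γ T` preserves `S` on both sides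
  have hgm : ((T⁻¹ * γ * T : GL (Fin (p + 1)) ℂ) : Matrix (Fin (p + 1)) (Fin (p + 1)) ℂ) = Ti * γm * Tm := by
    rw [Units.val_mul, Units.val_mul]
  have h1 : ((T⁻¹ * γ * T : GL (Fin (p + 1)) ℂ) : Matrix (Fin (p + 1)) (Fin (p + 1)) ℂ)ᴴ * signatureMatrix p *
      ((T⁻¹ * γ * T : GL (Fin (p + 1)) ℂ) : Matrix (Fin (p + 1)) (Fin (p + 1)) ℂ) = signatureMatrix p := by
    rw [hgm]
    calc (Ti * γm * Tm)ᴴ * signatureMatrix p * (Ti * γm * Tm) =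
        Tmᴴ * (γmᴴ * (Tiᴴ * signatureMatrix p * Ti) * γm) * Tm := by
          simp only [Matrix.conjTranspose_mul, Matrix.mul_assoc]
      _ = signatureMatrix p := by rw [hHc, hγ, hT]
  have h2 := mul_signatureMatrix_mul_conjTranspose_of (T⁻¹ * γ * T) h1
  have hb := hbound p _ h1 h2
  -- `γ = T g T⁻¹`
  have hγeq : γm = Tm * ((T⁻¹ * γ * T : GL (Fin (p + 1)) ℂ) : Matrix (Fin (p + 1)) (Fin (p + 1)) ℂ) * Ti := by
    rw [hγm, hTm, hTi, ← Units.val_mul, ← Units.val_mul]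
    congr 1
    group
  rw [hγeq]
  refine (norm_mul_mul_apply_le _ _ _ hb i j).trans (mul_le_mul_of_nonneg_right ?_ (norm_nonneg _))
  have hnn : ∀ i j, 0 ≤ ∑ l, ∑ k, ‖Tm i k‖ * ‖Ti l j‖ :=
    fun i j ↦ Finset.sum_nonneg fun l _ ↦ Finset.sum_nonneg fun k _ ↦
      mul_nonneg (norm_nonneg _) (norm_nonneg _)
  exact (Finset.single_le_sum (fun j _ ↦ hnn i j) (Finset.mem_univ j)).trans
    (Finset.single_le_sum (fun i _ ↦ Finset.sum_nonneg fun j _ ↦ hnn i j) (Finset.mem_univ i))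

end Summit.HodgeConjecture.HodgeConjecture.Cruxes.OrthogonalEnveloped.HeckeGraphChow

end
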